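import Summits.Ventures.CertifiedManyBodySolver.Observables.StiffnessApexTransportFermiSeaAnchor
import Summits.Ventures.CertifiedManyBodySolver.Observables.StiffnessParticleHoleMirror
import HarnessLib

/-!
# Ventures/CertifiedManyBodySolver — Observables/StiffnessApexTransportFermiSeaBoxes.lean

HONEST FRAMING: one-sided certified CEILINGS on the uniform flux stiffness (t–t′ f-sum class) at ANY density, on WHOLE BOXES `[U_a, U_b] × [t′₁, t′₂]` of the
`(U, t′)` plane — AREA words — by transport from ONE solved apex source plus a kernel Fermi-sea row; every word is CONDITIONAL on the source rows / row families it
names (the Fermi-sea rows are hypothesis-free kernel theorems); a ceiling never speaks to the presence of order; not a `T_c` estimate, not a superconductivity verdict;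
no number of record. Zero compute, no definition, no claim node, no `sorry`.

Cell `pub/hubbard-fast` (D-0154 (1)(A) «CERTIFICATE REUSE along parameter paths»), seat `hubbard-fast-reuse-2` g6 (`prover-hubbard-fast-reuse-2-g6-0`), path family
«APEX TRANSPORT», line «U-AFFINE BOXES»: the REUSE LEMMA in generic form. Companion of this seat's `Observables/StiffnessApexTransportFermiSeaAnchor.lean` (g4, p656029:
ONE interacting apex source × a kernel Fermi-sea row, barycentric weights at the target) and `Observables/StiffnessApexTransportRayStation.lean` (g4, p657780).

THE POINT. Fix a source `(s₁, U₁)` whose torus-limit ground-state class carries an AFFINE hopping floor `α + βκ ≤ e_{Φ(1,κ,0)}(ω)` for `κ` in a range `[κ_lo, κ_hi]`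
(companion `…AffineFloors`: the class's own f-sum word + a `K₂` floor [`κ ≥ 2s₁`] or + a `K₂` ceiling [`κ ≤ 2s₁`]; the σ-chord of two END objectives [`κ/2` between the two slots]; a `t′ = 0`
station's kinetic ceiling + a `K₂` floor [`κ ≥ 0`] or ceiling [`κ ≤ 0`]), and a kernel Fermi-sea row `ℓ₂ ≤ e(1, κ₂, 0, n)` at a FIXED hopping `κ₂`. At the target `(t, U)`,
`U > U₁`, the apex hopping is `κ₁ = K/d`, `K = Us₁ − U₁t`, `d = U − U₁`, and the weighted-bracket word inequality `c ≥ μ₁(−(α + βκ₁)/4) + μ₂(−ℓ₂/4)`,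
`μ₁ = (κ₂ − 2t)/(κ₂ − κ₁)`, multiplied by the positive `4(κ₂d − K)` reads (right anchor `κ₁ ≤ 2t < κ₂`; §1)

  `P(U, t) := 4c·(κ₂d − K) + (κ₂ − 2t)·(αd + βK) + ℓ₂·(2td − K) ≥ 0`,   every term = (a function of `t`) × (an AFFINE function of `U`).

Hence for fixed `t` the cleared form is AFFINE IN `U`, and for fixed `U` a QUADRATIC in `t`: a box `[U_a, U_b] × [t₁, t₂]` is worded by its two `U`-EDGE SECTIONS
(`∀ t ∈ [t₁,t₂], P(U_a,t) ≥ 0` and `P(U_b,t) ≥ 0`, quadratic certificates as in the g3/g4 section files) plus FOUR-CORNER admissibility (the `κ`-range and the bracket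
side are bilinear in `(U, t)`, §3 `bilinear_nonneg_on_box`) — §4. The box word equals the larger of the two edge-section words (exact, by the same affinity).

* §1 `ObsStiffnessSeqCeilingAt_of_apexSource_affineFloor_fermiSeaRow_right_cleared` / `…_left_cleared` — cleared point masters (anchor right / left of `2t`);
* (§2 = the companion `Observables/StiffnessApexTransportAffineFloors.lean`: adapters `affineHoppingFloor_of_ownSlot_floor` / `…_ceil` / `…_of_slotChord` / `…_of_station_floor` /
  `…_of_station_ceil` producing the affine floor from the tree's source shapes);
* §3 `bilinear_nonneg_on_box` (four-corner interpolation of `a + bU + ct + dUt`);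
* §4 `ObsStiffnessSeqCeilingAt_on_box_of_apexSource_affineFloor_fermiSeaRow_right` / `…_left` — THE BOX THEOREMS; §5 `box_twin_nine_div_eight` (⅞ ↦ 9/8 boxes, `4 ∣ L`).

NOT said: nothing flows toward `U ≤ U₁`; TWO interacting members at one station clear to a form QUADRATIC (and generically convex) in `U` — not a box by two edges (a
tangent-minorant edition would be needed); a Fermi-sea pair alone never beats the kinematic leaf; `λ ≠ 0` words are not of this form; no `T > 0`.

References: T. Koma, H. Tasaki, J. Stat. Phys. 76 (1994) 745, §1 [KomaTasaki1994]; D. J. Scalapino, S. R. White, S.-C. Zhang, PRB 47 (1993) 7995, §II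
[ScalapinoWhiteZhang1993]; T. Hazra, N. Verma, M. Randeria, PRX 9 (2019) 031049, eq. (4) [HazraVermaRanderia2019]; E. H. Lieb, M. Loss, Duke Math. J. 71 (1993) 337,
§8 Theorem 8.2 [LiebLoss1993]; E. H. Lieb, F. Y. Wu, Physica A 321 (2003) 1, §1 eq. (3) [LiebWuPhysicaA2003].
-/

noncomputable section

namespace Summit.Ventures.CertifiedManyBodySolver.Observables

open Literature.MathematicalPhysics.QuantumLattice
open Literature.MathematicalPhysics.QuantumLattice.ThermodynamicLimit
open Literature.MathematicalPhysics.QuantumFieldTheory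
open Literature.Probability.LatticeModels
open Matrix Finset Filter Topology HubbardWave0
open scoped Matrix BigOperators ComplexOrder

/-! ## §1 The cleared point masters: an affine source floor on a hopping range × one Fermi-sea row -/

section Cleared

variable {t U n s₁ U₁ : ℝ}

/-- **APEX × FERMI-SEA, CLEARED, anchor RIGHT of the target hopping** (`κ₁ ≤ 2t < κ₂`). Source `(s₁, U₁)`, `0 ≤ U₁ < U`, density `0 ≤ n < 2`, with an AFFINE hopping floor
`α + βκ ≤ e_{Φ(1,κ,0)}(ω)` on its torus-limit ground-state class for every `κ ∈ [κ_lo, κ_hi]`; a free-gas floor `ℓ₂ ≤ e(1, κ₂, 0, n)`. With `K = Us₁ − U₁t`, `d = U − U₁` (so the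
apex hopping is `κ₁ = K/d`): if `κ_lo d ≤ K ≤ κ_hi d`, `K ≤ 2td` (i.e. `κ₁ ≤ 2t`), `2t < κ₂`, and
`0 ≤ 4c(κ₂d − K) + (κ₂ − 2t)(αd + βK) + ℓ₂(2td − K)`, then `ObsStiffnessSeqCeilingAt t U n c` — the weighted bracket of the companion
(`ObsStiffnessSeqCeilingAt_of_apexSource_fermiSeaRow_weighted`) with `μ₁ = (κ₂ − 2t)d/(κ₂d − K)`, `μ₂ = (2td − K)/(κ₂d − K)`, denominators cleared.
[cite: KomaTasaki1994, §1] [cite: ScalapinoWhiteZhang1993, §II] [cite: LiebLoss1993, §8, Theorem 8.2] -/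
theorem ObsStiffnessSeqCeilingAt_of_apexSource_affineFloor_fermiSeaRow_right_cleared (hU₁0 : 0 ≤ U₁) (hU₁ : U₁ < U)
    (hn0 : 0 ≤ n) (hn2 : n < 2) {α β κlo κhi : ℝ}
    (h₁ : ∀ κ : ℝ, κlo ≤ κ → κ ≤ κhi →
      ∀ (ω : InfVolFermionState 2) (Ls : ℕ → ℕ) (ψ : ∀ L, Fock (Orb (FermionTorus 2 L))),
      Tendsto Ls atTop atTop →
      (∀ j, IsGroundStateInSector (hubbardTorusTT' (Ls j) 1 s₁ U₁) (rectN n (Ls j)) 0 (ψ (Ls j))) →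
      (∀ j, star (ψ (Ls j)) ⬝ᵥ ψ (Ls j) = 1) → ω.IsTorusLimitOf ψ Ls →
      α + β * κ ≤ ω.meanEnergy (hubbardTTPrimeFermionInteraction 1 κ 0) 1)
    {κ₂ ℓ₂ : ℝ} (h₂ : ℓ₂ ≤ energyDensityTT' 1 κ₂ 0 n)
    (hlo : κlo * (U - U₁) ≤ U * s₁ - U₁ * t) (hhi : U * s₁ - U₁ * t ≤ κhi * (U - U₁))
    (hbr : U * s₁ - U₁ * t ≤ 2 * t * (U - U₁)) (hτ : 2 * t < κ₂) (c : ℚ)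
    (hc : 0 ≤ 4 * ((c : ℚ) : ℝ) * (κ₂ * (U - U₁) - (U * s₁ - U₁ * t)) +
      (κ₂ - 2 * t) * (α * (U - U₁) + β * (U * s₁ - U₁ * t)) + ℓ₂ * (2 * t * (U - U₁) - (U * s₁ - U₁ * t))) :
    ObsStiffnessSeqCeilingAt t U n c := by
  have hd : 0 < U - U₁ := sub_pos.2 hU₁
  have hE : 0 < κ₂ * (U - U₁) - (U * s₁ - U₁ * t) := by nlinarith
  have hκ₁d : (U * s₁ - U₁ * t) / (U - U₁) * (U - U₁) = U * s₁ - U₁ * t := div_mul_cancel₀ _ hd.ne'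
  have hκlo : κlo ≤ (U * s₁ - U₁ * t) / (U - U₁) := by rw [le_div_iff₀ hd]; exact hlo
  have hκhi : (U * s₁ - U₁ * t) / (U - U₁) ≤ κhi := by rw [div_le_iff₀ hd]; exact hhi
  refine ObsStiffnessSeqCeilingAt_of_apexSource_fermiSeaRow_weighted (s₁ := s₁) (U₁ := U₁) (t'P := t) (UP := U) (n := n)
    hU₁0 hU₁ hn0 hn2 (μ₁ := (κ₂ - 2 * t) * (U - U₁) / (κ₂ * (U - U₁) - (U * s₁ - U₁ * t)))
    (μ₂ := (2 * t * (U - U₁) - (U * s₁ - U₁ * t)) / (κ₂ * (U - U₁) - (U * s₁ - U₁ * t)))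
    (div_nonneg (mul_nonneg (by linarith) hd.le) hE.le) (div_nonneg (by linarith) hE.le) ?_ κ₂ ?_
    (h₁ _ hκlo hκhi) h₂ c ?_
  · rw [← add_div, div_eq_one_iff_eq hE.ne']; ring
  · rw [div_mul_eq_mul_div, div_mul_eq_mul_div, ← add_div, div_eq_iff hE.ne']
    have e : (κ₂ - 2 * t) * (U - U₁) * ((U * s₁ - U₁ * t) / (U - U₁)) = (κ₂ - 2 * t) * (U * s₁ - U₁ * t) := by
      rw [mul_assoc, mul_comm (U - U₁), hκ₁d]
    rw [e]; ring
  · -- the word inequality, denominators cleared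
    have key : (κ₂ - 2 * t) * (U - U₁) / (κ₂ * (U - U₁) - (U * s₁ - U₁ * t)) * (α + β * ((U * s₁ - U₁ * t) / (U - U₁))) +
        (2 * t * (U - U₁) - (U * s₁ - U₁ * t)) / (κ₂ * (U - U₁) - (U * s₁ - U₁ * t)) * ℓ₂ =
        ((κ₂ - 2 * t) * (α * (U - U₁) + β * (U * s₁ - U₁ * t)) + ℓ₂ * (2 * t * (U - U₁) - (U * s₁ - U₁ * t))) /
          (κ₂ * (U - U₁) - (U * s₁ - U₁ * t)) := by
      have hd' : U - U₁ ≠ 0 := hd.ne'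
      have hE' : κ₂ * (U - U₁) - (U * s₁ - U₁ * t) ≠ 0 := hE.ne'
      field_simp
    rw [key]
    have hN : -(4 * ((c : ℚ) : ℝ)) * (κ₂ * (U - U₁) - (U * s₁ - U₁ * t)) ≤
        (κ₂ - 2 * t) * (α * (U - U₁) + β * (U * s₁ - U₁ * t)) + ℓ₂ * (2 * t * (U - U₁) - (U * s₁ - U₁ * t)) := by
      linarith
    have hNE := (le_div_iff₀ hE).2 hN
    linarith

/-- **APEX × FERMI-SEA, CLEARED, anchor LEFT of the target hopping** (`κ₂ < 2t ≤ κ₁`). Same source data; with `K = Us₁ − U₁t`, `d = U − U₁`: if `κ_lo d ≤ K ≤ κ_hi d`,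
`2td ≤ K` (i.e. `2t ≤ κ₁`), `κ₂ < 2t`, and `0 ≤ 4c(K − κ₂d) + (2t − κ₂)(αd + βK) + ℓ₂(K − 2td)`, then `ObsStiffnessSeqCeilingAt t U n c` (weights
`μ₁ = (2t − κ₂)d/(K − κ₂d)`, `μ₂ = (K − 2td)/(K − κ₂d)`, the companion's `anchor_weights_left`, cleared). [cite: KomaTasaki1994, §1] [cite: ScalapinoWhiteZhang1993, §II] [cite: LiebLoss1993, §8, Theorem 8.2] -/
theorem ObsStiffnessSeqCeilingAt_of_apexSource_affineFloor_fermiSeaRow_left_cleared (hU₁0 : 0 ≤ U₁) (hU₁ : U₁ < U)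
    (hn0 : 0 ≤ n) (hn2 : n < 2) {α β κlo κhi : ℝ}
    (h₁ : ∀ κ : ℝ, κlo ≤ κ → κ ≤ κhi →
      ∀ (ω : InfVolFermionState 2) (Ls : ℕ → ℕ) (ψ : ∀ L, Fock (Orb (FermionTorus 2 L))),
      Tendsto Ls atTop atTop →
      (∀ j, IsGroundStateInSector (hubbardTorusTT' (Ls j) 1 s₁ U₁) (rectN n (Ls j)) 0 (ψ (Ls j))) →
      (∀ j, star (ψ (Ls j)) ⬝ᵥ ψ (Ls j) = 1) → ω.IsTorusLimitOf ψ Ls →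
      α + β * κ ≤ ω.meanEnergy (hubbardTTPrimeFermionInteraction 1 κ 0) 1)
    {κ₂ ℓ₂ : ℝ} (h₂ : ℓ₂ ≤ energyDensityTT' 1 κ₂ 0 n)
    (hlo : κlo * (U - U₁) ≤ U * s₁ - U₁ * t) (hhi : U * s₁ - U₁ * t ≤ κhi * (U - U₁))
    (hbr : 2 * t * (U - U₁) ≤ U * s₁ - U₁ * t) (hτ : κ₂ < 2 * t) (c : ℚ)
    (hc : 0 ≤ 4 * ((c : ℚ) : ℝ) * ((U * s₁ - U₁ * t) - κ₂ * (U - U₁)) +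
      (2 * t - κ₂) * (α * (U - U₁) + β * (U * s₁ - U₁ * t)) + ℓ₂ * ((U * s₁ - U₁ * t) - 2 * t * (U - U₁))) :
    ObsStiffnessSeqCeilingAt t U n c := by
  have hd : 0 < U - U₁ := sub_pos.2 hU₁
  have hE : 0 < (U * s₁ - U₁ * t) - κ₂ * (U - U₁) := by nlinarith
  have hκ₁d : (U * s₁ - U₁ * t) / (U - U₁) * (U - U₁) = U * s₁ - U₁ * t := div_mul_cancel₀ _ hd.ne'
  have hκlo : κlo ≤ (U * s₁ - U₁ * t) / (U - U₁) := by rw [le_div_iff₀ hd]; exact hlo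
  have hκhi : (U * s₁ - U₁ * t) / (U - U₁) ≤ κhi := by rw [div_le_iff₀ hd]; exact hhi
  refine ObsStiffnessSeqCeilingAt_of_apexSource_fermiSeaRow_weighted (s₁ := s₁) (U₁ := U₁) (t'P := t) (UP := U) (n := n)
    hU₁0 hU₁ hn0 hn2 (μ₁ := (2 * t - κ₂) * (U - U₁) / ((U * s₁ - U₁ * t) - κ₂ * (U - U₁)))
    (μ₂ := ((U * s₁ - U₁ * t) - 2 * t * (U - U₁)) / ((U * s₁ - U₁ * t) - κ₂ * (U - U₁)))
    (div_nonneg (mul_nonneg (by linarith) hd.le) hE.le) (div_nonneg (by linarith) hE.le) ?_ κ₂ ?_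
    (h₁ _ hκlo hκhi) h₂ c ?_
  · rw [← add_div, div_eq_one_iff_eq hE.ne']; ring
  · rw [div_mul_eq_mul_div, div_mul_eq_mul_div, ← add_div, div_eq_iff hE.ne']
    have e : (2 * t - κ₂) * (U - U₁) * ((U * s₁ - U₁ * t) / (U - U₁)) = (2 * t - κ₂) * (U * s₁ - U₁ * t) := by
      rw [mul_assoc, mul_comm (U - U₁), hκ₁d]
    rw [e]; ring
  · have key : (2 * t - κ₂) * (U - U₁) / ((U * s₁ - U₁ * t) - κ₂ * (U - U₁)) * (α + β * ((U * s₁ - U₁ * t) / (U - U₁))) +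
        ((U * s₁ - U₁ * t) - 2 * t * (U - U₁)) / ((U * s₁ - U₁ * t) - κ₂ * (U - U₁)) * ℓ₂ =
        ((2 * t - κ₂) * (α * (U - U₁) + β * (U * s₁ - U₁ * t)) + ℓ₂ * ((U * s₁ - U₁ * t) - 2 * t * (U - U₁))) /
          ((U * s₁ - U₁ * t) - κ₂ * (U - U₁)) := by
      have hd' : U - U₁ ≠ 0 := hd.ne'
      have hE' : (U * s₁ - U₁ * t) - κ₂ * (U - U₁) ≠ 0 := hE.ne'
      field_simp
    rw [key]
    have hN : -(4 * ((c : ℚ) : ℝ)) * ((U * s₁ - U₁ * t) - κ₂ * (U - U₁)) ≤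
        (2 * t - κ₂) * (α * (U - U₁) + β * (U * s₁ - U₁ * t)) + ℓ₂ * ((U * s₁ - U₁ * t) - 2 * t * (U - U₁)) := by
      linarith
    have hNE := (le_div_iff₀ hE).2 hN
    linarith

end Cleared

/-! ## §3 Arithmetic: four-corner interpolation of a bilinear form on a box -/

/-- **A form `a + bU + ct + dUt` (affine in each variable) that is `≥ 0` at the four corners of `[U_a, U_b] × [t₁, t₂]` is `≥ 0` on the box**: it is the
barycentric (bilinear) interpolation of its corner values. [folklore] -/
theorem bilinear_nonneg_on_box {a b c d Ua Ub t₁ t₂ U t : ℝ} (hab : Ua < Ub) (h12 : t₁ < t₂)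
    (hU : U ∈ Set.Icc Ua Ub) (ht : t ∈ Set.Icc t₁ t₂)
    (h₁ : 0 ≤ a + b * Ua + c * t₁ + d * Ua * t₁) (h₂ : 0 ≤ a + b * Ua + c * t₂ + d * Ua * t₂)
    (h₃ : 0 ≤ a + b * Ub + c * t₁ + d * Ub * t₁) (h₄ : 0 ≤ a + b * Ub + c * t₂ + d * Ub * t₂) :
    0 ≤ a + b * U + c * t + d * U * t := by
  obtain ⟨hUa, hUb⟩ := hU
  obtain ⟨hta, htb⟩ := ht
  have hpos : 0 < (Ub - Ua) * (t₂ - t₁) := mul_pos (sub_pos.2 hab) (sub_pos.2 h12)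
  have key : (Ub - Ua) * (t₂ - t₁) * (a + b * U + c * t + d * U * t) =
      (Ub - U) * (t₂ - t) * (a + b * Ua + c * t₁ + d * Ua * t₁) + (Ub - U) * (t - t₁) * (a + b * Ua + c * t₂ + d * Ua * t₂) +
      (U - Ua) * (t₂ - t) * (a + b * Ub + c * t₁ + d * Ub * t₁) + (U - Ua) * (t - t₁) * (a + b * Ub + c * t₂ + d * Ub * t₂) := by
    ring
  have hnn : 0 ≤ (Ub - Ua) * (t₂ - t₁) * (a + b * U + c * t + d * U * t) := by
    rw [key]
    have := mul_nonneg (mul_nonneg (sub_nonneg.2 hUb) (sub_nonneg.2 htb)) h₁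
    have := mul_nonneg (mul_nonneg (sub_nonneg.2 hUb) (sub_nonneg.2 hta)) h₂
    have := mul_nonneg (mul_nonneg (sub_nonneg.2 hUa) (sub_nonneg.2 htb)) h₃
    have := mul_nonneg (mul_nonneg (sub_nonneg.2 hUa) (sub_nonneg.2 hta)) h₄
    linarith
  exact (mul_nonneg_iff_of_pos_left hpos).1 hnn

/-! ## §4 THE BOX THEOREMS: two `U`-edge sections + four corners word the whole box -/

section Box

variable {n s₁ U₁ : ℝ}

/-- **BOX WORD, anchor RIGHT** (`κ₁ ≤ 2t < κ₂` on the box). Source `(s₁, U₁)`, `0 ≤ U₁`, with an affine hopping floor `α + βκ` on `[κ_lo, κ_hi]` (§2); a free-gas floor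
`ℓ₂ ≤ e(1, κ₂, 0, n)` at the FIXED hopping `κ₂`; a box `U₁ < U_a < U_b`, `t₁ < t₂`, `2t₂ < κ₂`. If at the FOUR CORNERS the apex hopping is in range and left of the target
(`κ_lo d ≤ K ≤ κ_hi d`, `K ≤ 2td` with `K = Us₁ − U₁t`, `d = U − U₁` — bilinear in `(U, t)`), and on the TWO `U`-EDGES the cleared word inequality holds for every `t ∈ [t₁, t₂]`
(`0 ≤ P(U_a, t)` and `0 ≤ P(U_b, t)`, `P(U,t) = 4c(κ₂d − K) + (κ₂ − 2t)(αd + βK) + ℓ₂(2td − K)`, a quadratic in `t` on each edge), then `ObsStiffnessSeqCeilingAt t U n c` at EVERY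
point of the box: `P` is affine in `U` at fixed `t`, so `(U_b − U_a)P(U,t) = (U_b − U)P(U_a,t) + (U − U_a)P(U_b,t) ≥ 0`, and §1 applies.
[cite: KomaTasaki1994, §1] [cite: ScalapinoWhiteZhang1993, §II] [cite: LiebLoss1993, §8, Theorem 8.2] -/
theorem ObsStiffnessSeqCeilingAt_on_box_of_apexSource_affineFloor_fermiSeaRow_right (hU₁0 : 0 ≤ U₁)
    (hn0 : 0 ≤ n) (hn2 : n < 2) {α β κlo κhi : ℝ}
    (h₁ : ∀ κ : ℝ, κlo ≤ κ → κ ≤ κhi →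
      ∀ (ω : InfVolFermionState 2) (Ls : ℕ → ℕ) (ψ : ∀ L, Fock (Orb (FermionTorus 2 L))),
      Tendsto Ls atTop atTop →
      (∀ j, IsGroundStateInSector (hubbardTorusTT' (Ls j) 1 s₁ U₁) (rectN n (Ls j)) 0 (ψ (Ls j))) →
      (∀ j, star (ψ (Ls j)) ⬝ᵥ ψ (Ls j) = 1) → ω.IsTorusLimitOf ψ Ls →
      α + β * κ ≤ ω.meanEnergy (hubbardTTPrimeFermionInteraction 1 κ 0) 1)
    {κ₂ ℓ₂ : ℝ} (h₂ : ℓ₂ ≤ energyDensityTT' 1 κ₂ 0 n)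
    {Ua Ub t₁ t₂ : ℝ} (hUa : U₁ < Ua) (hab : Ua < Ub) (h12 : t₁ < t₂) (hτ : 2 * t₂ < κ₂)
    (hlo₁ : κlo * (Ua - U₁) ≤ Ua * s₁ - U₁ * t₁) (hlo₂ : κlo * (Ua - U₁) ≤ Ua * s₁ - U₁ * t₂)
    (hlo₃ : κlo * (Ub - U₁) ≤ Ub * s₁ - U₁ * t₁) (hlo₄ : κlo * (Ub - U₁) ≤ Ub * s₁ - U₁ * t₂)
    (hhi₁ : Ua * s₁ - U₁ * t₁ ≤ κhi * (Ua - U₁)) (hhi₂ : Ua * s₁ - U₁ * t₂ ≤ κhi * (Ua - U₁))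
    (hhi₃ : Ub * s₁ - U₁ * t₁ ≤ κhi * (Ub - U₁)) (hhi₄ : Ub * s₁ - U₁ * t₂ ≤ κhi * (Ub - U₁))
    (hbr₁ : Ua * s₁ - U₁ * t₁ ≤ 2 * t₁ * (Ua - U₁)) (hbr₂ : Ua * s₁ - U₁ * t₂ ≤ 2 * t₂ * (Ua - U₁))
    (hbr₃ : Ub * s₁ - U₁ * t₁ ≤ 2 * t₁ * (Ub - U₁)) (hbr₄ : Ub * s₁ - U₁ * t₂ ≤ 2 * t₂ * (Ub - U₁)) (c : ℚ)
    (hPa : ∀ t ∈ Set.Icc t₁ t₂, 0 ≤ 4 * ((c : ℚ) : ℝ) * (κ₂ * (Ua - U₁) - (Ua * s₁ - U₁ * t)) +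
      (κ₂ - 2 * t) * (α * (Ua - U₁) + β * (Ua * s₁ - U₁ * t)) + ℓ₂ * (2 * t * (Ua - U₁) - (Ua * s₁ - U₁ * t)))
    (hPb : ∀ t ∈ Set.Icc t₁ t₂, 0 ≤ 4 * ((c : ℚ) : ℝ) * (κ₂ * (Ub - U₁) - (Ub * s₁ - U₁ * t)) +
      (κ₂ - 2 * t) * (α * (Ub - U₁) + β * (Ub * s₁ - U₁ * t)) + ℓ₂ * (2 * t * (Ub - U₁) - (Ub * s₁ - U₁ * t))) :
    ∀ U ∈ Set.Icc Ua Ub, ∀ t ∈ Set.Icc t₁ t₂, ObsStiffnessSeqCeilingAt t U n c := by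
  intro U hU t ht
  have hUlt : U₁ < U := hUa.trans_le hU.1
  -- corner interpolation of the three bilinear side conditions
  have hlo : κlo * (U - U₁) ≤ U * s₁ - U₁ * t := by
    have h := bilinear_nonneg_on_box (a := κlo * U₁) (b := s₁ - κlo) (c := -U₁) (d := 0) hab h12 hU ht
      (by linarith) (by linarith) (by linarith) (by linarith)
    linarith
  have hhi : U * s₁ - U₁ * t ≤ κhi * (U - U₁) := by
    have h := bilinear_nonneg_on_box (a := -(κhi * U₁)) (b := κhi - s₁) (c := U₁) (d := 0) hab h12 hU ht
      (by linarith) (by linarith) (by linarith) (by linarith)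
    linarith
  have hbr : U * s₁ - U₁ * t ≤ 2 * t * (U - U₁) := by
    have h := bilinear_nonneg_on_box (a := 0) (b := -s₁) (c := -U₁) (d := 2) hab h12 hU ht
      (by linarith) (by linarith) (by linarith) (by linarith)
    linarith
  have hτ' : 2 * t < κ₂ := by linarith [ht.2]
  refine ObsStiffnessSeqCeilingAt_of_apexSource_affineFloor_fermiSeaRow_right_cleared hU₁0 hUlt hn0 hn2 h₁ h₂ hlo hhi hbr
    hτ' c ?_
  -- the word inequality is affine in `U` at fixed `t`
  have ha := hPa t ht
  have hb := hPb t ht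
  have key : (Ub - Ua) * (4 * ((c : ℚ) : ℝ) * (κ₂ * (U - U₁) - (U * s₁ - U₁ * t)) +
      (κ₂ - 2 * t) * (α * (U - U₁) + β * (U * s₁ - U₁ * t)) + ℓ₂ * (2 * t * (U - U₁) - (U * s₁ - U₁ * t))) =
      (Ub - U) * (4 * ((c : ℚ) : ℝ) * (κ₂ * (Ua - U₁) - (Ua * s₁ - U₁ * t)) +
        (κ₂ - 2 * t) * (α * (Ua - U₁) + β * (Ua * s₁ - U₁ * t)) + ℓ₂ * (2 * t * (Ua - U₁) - (Ua * s₁ - U₁ * t))) +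
      (U - Ua) * (4 * ((c : ℚ) : ℝ) * (κ₂ * (Ub - U₁) - (Ub * s₁ - U₁ * t)) +
        (κ₂ - 2 * t) * (α * (Ub - U₁) + β * (Ub * s₁ - U₁ * t)) + ℓ₂ * (2 * t * (Ub - U₁) - (Ub * s₁ - U₁ * t))) := by
    ring
  have hnn : 0 ≤ (Ub - Ua) * (4 * ((c : ℚ) : ℝ) * (κ₂ * (U - U₁) - (U * s₁ - U₁ * t)) +
      (κ₂ - 2 * t) * (α * (U - U₁) + β * (U * s₁ - U₁ * t)) + ℓ₂ * (2 * t * (U - U₁) - (U * s₁ - U₁ * t))) := by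
    rw [key]
    exact add_nonneg (mul_nonneg (sub_nonneg.2 hU.2) ha) (mul_nonneg (sub_nonneg.2 hU.1) hb)
  exact (mul_nonneg_iff_of_pos_left (sub_pos.2 hab)).1 hnn

/-- **BOX WORD, anchor LEFT** (`κ₂ < 2t ≤ κ₁` on the box; e.g. a Fermi-sea row at `κ₂ ≤ 2t₁` and the `(8, 7/8, 0)` ray station for `t < 0`). Same data with
`κ₂ < 2t₁`; corners: `κ_lo d ≤ K ≤ κ_hi d`, `2td ≤ K`; edges: `0 ≤ P′(U_e, t)` on `[t₁, t₂]`, `P′(U,t) = 4c(K − κ₂d) + (2t − κ₂)(αd + βK) + ℓ₂(K − 2td)`. Then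
`ObsStiffnessSeqCeilingAt t U n c` on the whole box. [cite: KomaTasaki1994, §1] [cite: ScalapinoWhiteZhang1993, §II] [cite: LiebLoss1993, §8, Theorem 8.2] -/
theorem ObsStiffnessSeqCeilingAt_on_box_of_apexSource_affineFloor_fermiSeaRow_left (hU₁0 : 0 ≤ U₁)
    (hn0 : 0 ≤ n) (hn2 : n < 2) {α β κlo κhi : ℝ}
    (h₁ : ∀ κ : ℝ, κlo ≤ κ → κ ≤ κhi →
      ∀ (ω : InfVolFermionState 2) (Ls : ℕ → ℕ) (ψ : ∀ L, Fock (Orb (FermionTorus 2 L))),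
      Tendsto Ls atTop atTop →
      (∀ j, IsGroundStateInSector (hubbardTorusTT' (Ls j) 1 s₁ U₁) (rectN n (Ls j)) 0 (ψ (Ls j))) →
      (∀ j, star (ψ (Ls j)) ⬝ᵥ ψ (Ls j) = 1) → ω.IsTorusLimitOf ψ Ls →
      α + β * κ ≤ ω.meanEnergy (hubbardTTPrimeFermionInteraction 1 κ 0) 1)
    {κ₂ ℓ₂ : ℝ} (h₂ : ℓ₂ ≤ energyDensityTT' 1 κ₂ 0 n)
    {Ua Ub t₁ t₂ : ℝ} (hUa : U₁ < Ua) (hab : Ua < Ub) (h12 : t₁ < t₂) (hτ : κ₂ < 2 * t₁)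
    (hlo₁ : κlo * (Ua - U₁) ≤ Ua * s₁ - U₁ * t₁) (hlo₂ : κlo * (Ua - U₁) ≤ Ua * s₁ - U₁ * t₂)
    (hlo₃ : κlo * (Ub - U₁) ≤ Ub * s₁ - U₁ * t₁) (hlo₄ : κlo * (Ub - U₁) ≤ Ub * s₁ - U₁ * t₂)
    (hhi₁ : Ua * s₁ - U₁ * t₁ ≤ κhi * (Ua - U₁)) (hhi₂ : Ua * s₁ - U₁ * t₂ ≤ κhi * (Ua - U₁))
    (hhi₃ : Ub * s₁ - U₁ * t₁ ≤ κhi * (Ub - U₁)) (hhi₄ : Ub * s₁ - U₁ * t₂ ≤ κhi * (Ub - U₁))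
    (hbr₁ : 2 * t₁ * (Ua - U₁) ≤ Ua * s₁ - U₁ * t₁) (hbr₂ : 2 * t₂ * (Ua - U₁) ≤ Ua * s₁ - U₁ * t₂)
    (hbr₃ : 2 * t₁ * (Ub - U₁) ≤ Ub * s₁ - U₁ * t₁) (hbr₄ : 2 * t₂ * (Ub - U₁) ≤ Ub * s₁ - U₁ * t₂) (c : ℚ)
    (hPa : ∀ t ∈ Set.Icc t₁ t₂, 0 ≤ 4 * ((c : ℚ) : ℝ) * ((Ua * s₁ - U₁ * t) - κ₂ * (Ua - U₁)) +
      (2 * t - κ₂) * (α * (Ua - U₁) + β * (Ua * s₁ - U₁ * t)) + ℓ₂ * ((Ua * s₁ - U₁ * t) - 2 * t * (Ua - U₁)))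
    (hPb : ∀ t ∈ Set.Icc t₁ t₂, 0 ≤ 4 * ((c : ℚ) : ℝ) * ((Ub * s₁ - U₁ * t) - κ₂ * (Ub - U₁)) +
      (2 * t - κ₂) * (α * (Ub - U₁) + β * (Ub * s₁ - U₁ * t)) + ℓ₂ * ((Ub * s₁ - U₁ * t) - 2 * t * (Ub - U₁))) :
    ∀ U ∈ Set.Icc Ua Ub, ∀ t ∈ Set.Icc t₁ t₂, ObsStiffnessSeqCeilingAt t U n c := by
  intro U hU t ht
  have hUlt : U₁ < U := hUa.trans_le hU.1
  have hlo : κlo * (U - U₁) ≤ U * s₁ - U₁ * t := by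
    have h := bilinear_nonneg_on_box (a := κlo * U₁) (b := s₁ - κlo) (c := -U₁) (d := 0) hab h12 hU ht
      (by linarith) (by linarith) (by linarith) (by linarith)
    linarith
  have hhi : U * s₁ - U₁ * t ≤ κhi * (U - U₁) := by
    have h := bilinear_nonneg_on_box (a := -(κhi * U₁)) (b := κhi - s₁) (c := U₁) (d := 0) hab h12 hU ht
      (by linarith) (by linarith) (by linarith) (by linarith)
    linarith
  have hbr : 2 * t * (U - U₁) ≤ U * s₁ - U₁ * t := by
    have h := bilinear_nonneg_on_box (a := 0) (b := s₁) (c := U₁) (d := -2) hab h12 hU ht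
      (by linarith) (by linarith) (by linarith) (by linarith)
    linarith
  have hτ' : κ₂ < 2 * t := by linarith [ht.1]
  refine ObsStiffnessSeqCeilingAt_of_apexSource_affineFloor_fermiSeaRow_left_cleared hU₁0 hUlt hn0 hn2 h₁ h₂ hlo hhi hbr
    hτ' c ?_
  have ha := hPa t ht
  have hb := hPb t ht
  have key : (Ub - Ua) * (4 * ((c : ℚ) : ℝ) * ((U * s₁ - U₁ * t) - κ₂ * (U - U₁)) +
      (2 * t - κ₂) * (α * (U - U₁) + β * (U * s₁ - U₁ * t)) + ℓ₂ * ((U * s₁ - U₁ * t) - 2 * t * (U - U₁))) =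
      (Ub - U) * (4 * ((c : ℚ) : ℝ) * ((Ua * s₁ - U₁ * t) - κ₂ * (Ua - U₁)) +
        (2 * t - κ₂) * (α * (Ua - U₁) + β * (Ua * s₁ - U₁ * t)) + ℓ₂ * ((Ua * s₁ - U₁ * t) - 2 * t * (Ua - U₁))) +
      (U - Ua) * (4 * ((c : ℚ) : ℝ) * ((Ub * s₁ - U₁ * t) - κ₂ * (Ub - U₁)) +
        (2 * t - κ₂) * (α * (Ub - U₁) + β * (Ub * s₁ - U₁ * t)) + ℓ₂ * ((Ub * s₁ - U₁ * t) - 2 * t * (Ub - U₁))) := by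
    ring
  have hnn : 0 ≤ (Ub - Ua) * (4 * ((c : ℚ) : ℝ) * ((U * s₁ - U₁ * t) - κ₂ * (U - U₁)) +
      (2 * t - κ₂) * (α * (U - U₁) + β * (U * s₁ - U₁ * t)) + ℓ₂ * ((U * s₁ - U₁ * t) - 2 * t * (U - U₁))) := by
    rw [key]
    exact add_nonneg (mul_nonneg (sub_nonneg.2 hU.2) ha) (mul_nonneg (sub_nonneg.2 hU.1) hb)
  exact (mul_nonneg_iff_of_pos_left (sub_pos.2 hab)).1 hnn

end Box

/-! ## §5 The `7/8 ↦ 9/8` particle–hole twin of a box word (`4 ∣ L`) -/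

/-- **Electron-doped twin of a ⅞ box**: a box word `∀ U ∈ [U_a,U_b], ∀ t ∈ [t₁,t₂], ObsStiffnessSeqCeilingAt t U (7/8) c` gives, on the sides `4 ∣ L`, the mirrored box
`∀ U ∈ [U_a,U_b], ∀ t ∈ [−t₂,−t₁], ObsStiffnessSeqCeilingOnMultiples 4 t U (9/8) c` (`ObsStiffnessSeqCeilingAt.twin_nine_div_eight` pointwise). Dictionary class.
[cite: LiebWuPhysicaA2003, §1 eq. (3)] [cite: ScalapinoWhiteZhang1993, §II] -/
theorem box_twin_nine_div_eight {Ua Ub t₁ t₂ : ℝ} {c : ℚ}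
    (h : ∀ U ∈ Set.Icc Ua Ub, ∀ t ∈ Set.Icc t₁ t₂, ObsStiffnessSeqCeilingAt t U (7 / 8) c) :
    ∀ U ∈ Set.Icc Ua Ub, ∀ t ∈ Set.Icc (-t₂) (-t₁), ObsStiffnessSeqCeilingOnMultiples 4 t U (9 / 8) c := by
  intro U hU t ht
  have h' := (h U hU (-t) ⟨by linarith [ht.2], by linarith [ht.1]⟩).twin_nine_div_eight
  rwa [neg_neg] at h'

end Summit.Ventures.CertifiedManyBodySolver.Observables

end
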